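import Literature.Probability.LatticeModels.LeeYangLatticeLawMoments

/-!
# `stub_leeYangPackage` (S1b) for line `SketchPub` of crux `CoulombImpliesNontrivial`

Newman's Lee–Yang package for a lattice law (C. M. Newman, Comm. Math. Phys. 41 (1975), Prop. 2 and
Thms 3, 4, 7, lattice form): a symmetric pmf `p` on `[-K, K] ∩ (K + 2ℤ)` whose Laplace transform has
only imaginary zeros factorises as `∑ p_k e^{zk} = cosh^m z ∏ᵢ (1 + bᵢ sinh² z)` (`bᵢ ≥ 1`,
`m + 2n ≤ K`), whence the `cos`/`cosh` product formulas, the tilted mean, `u₂ = m + 2∑bᵢ`, Newman's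
inequality `2m + 12∑bᵢ² - 8∑bᵢ ≤ 3u₂² - ∑ p_k k⁴` and the first-zero bound `12/θ⁴ ≤ 3u₂² - ∑ p_k k⁴`.
All the mathematics is in `Literature/Probability/LatticeModels/LeeYangLatticeLaw{Roots,,Moments}.lean`
(namespace `Literature.Probability.LatticeModels.LeeYangLatticeLaw`); this file only assembles the
registered statement.
-/

noncomputable section

namespace Summit.CriticalPhenomena.Ising3DConformalLimit.PerfectScreeningCoulombImpliesNontrivial

open Literature.Probability.LatticeModels Filter Set Finset
open scoped Topology BigOperators

/-- **S1b — Newman's Lee–Yang package for a lattice law.** A symmetric pmf `p` on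
`[-K, K] ∩ (K + 2ℤ)` whose Laplace transform has only imaginary zeros factorises:
`∑ p_k cos(θk) = cos^m θ ∏ᵢ (1 - bᵢ sin² θ)`, `∑ p_k e^{tk} = cosh^m t ∏ᵢ (1 + bᵢ sinh² t)` with
`bᵢ ≥ 1`, `m + 2n ≤ K`; hence the tilted mean, `u₂ = m + 2∑bᵢ`, Newman's coefficient inequality
`2m + 12∑bᵢ² - 8∑bᵢ ≤ 3u₂² - ∑ p_k k⁴`, and Newman's first-zero bound `12/θ⁴ ≤ 3u₂² - ∑ p_k k⁴` at
every zero `θ > 0` of `∑ p_k cos(θk)` (Newman 1975, Prop. 2, Thms 3, 4, 7, lattice form; assembled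
from `LeeYangLatticeLaw.exists_laplace_eq_cosh_pow_mul_prod` and its corollaries). -/
theorem stub_leeYangPackage :
    ∀ (K : ℕ) (p : ℤ → ℝ), (∀ k, 0 ≤ p k) → (∀ k, p (-k) = p k) →
      (∀ k : ℤ, ¬ (2 ∣ (k + K)) → p k = 0) →
      (∑ k ∈ Finset.Icc (-(K : ℤ)) K, p k = 1) →
      (∀ z : ℂ, (∑ k ∈ Finset.Icc (-(K : ℤ)) K, (p k : ℂ) * Complex.exp (z * (k : ℂ))) = 0 → z.re = 0) →
      ∃ (m n : ℕ) (b : Fin n → ℝ), (∀ i, 1 ≤ b i) ∧ (m + 2 * n ≤ K) ∧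
        (∀ θ : ℝ, ∑ k ∈ Finset.Icc (-(K : ℤ)) K, p k * Real.cos (θ * k) =
          Real.cos θ ^ m * ∏ i, (1 - b i * Real.sin θ ^ 2)) ∧
        (∀ t : ℝ, ∑ k ∈ Finset.Icc (-(K : ℤ)) K, p k * Real.exp (t * k) =
          Real.cosh t ^ m * ∏ i, (1 + b i * Real.sinh t ^ 2)) ∧
        (∀ t : ℝ, ∑ k ∈ Finset.Icc (-(K : ℤ)) K, p k * (k * Real.exp (t * k)) =
          (Real.cosh t ^ m * ∏ i, (1 + b i * Real.sinh t ^ 2)) *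
            (m * Real.tanh t + ∑ i, 2 * b i * Real.sinh t * Real.cosh t / (1 + b i * Real.sinh t ^ 2))) ∧
        ((m : ℝ) + 2 * ∑ i, b i = ∑ k ∈ Finset.Icc (-(K : ℤ)) K, p k * (k : ℝ) ^ 2) ∧
        (2 * (m : ℝ) + 12 * ∑ i, b i ^ 2 - 8 * ∑ i, b i ≤
          3 * (∑ k ∈ Finset.Icc (-(K : ℤ)) K, p k * (k : ℝ) ^ 2) ^ 2 -
            ∑ k ∈ Finset.Icc (-(K : ℤ)) K, p k * (k : ℝ) ^ 4) ∧
        (∀ θ : ℝ, 0 < θ → ∑ k ∈ Finset.Icc (-(K : ℤ)) K, p k * Real.cos (θ * k) = 0 →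
          12 / θ ^ 4 ≤ 3 * (∑ k ∈ Finset.Icc (-(K : ℤ)) K, p k * (k : ℝ) ^ 2) ^ 2 -
            ∑ k ∈ Finset.Icc (-(K : ℤ)) K, p k * (k : ℝ) ^ 4) := by
  intro K p h0 hsymm hpar hsum hLY
  obtain ⟨m, n, b, hb, hmn, hmaster⟩ :=
    LeeYangLatticeLaw.exists_laplace_eq_cosh_pow_mul_prod K p h0 hsymm hpar hsum hLY
  have hcos := fun θ => LeeYangLatticeLaw.sum_mul_cos_eq_of_laplace hmaster θ
  have hexp := fun t => LeeYangLatticeLaw.sum_mul_exp_eq_of_laplace hmaster t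
  have hb0 : ∀ i, 0 ≤ b i := fun i => zero_le_one.trans (hb i)
  obtain ⟨hu2, hineq⟩ := LeeYangLatticeLaw.sum_mul_sq_eq_and_newman_ineq K p h0 hsymm hpar hsum hb hexp
  exact ⟨m, n, b, hb, hmn, hcos, hexp, fun t => LeeYangLatticeLaw.sum_mul_mul_exp_eq_of_sum_mul_exp_eq hb0 hexp t,
    hu2, hineq, fun θ hθ hz => LeeYangLatticeLaw.twelve_div_pow_four_le_of_sum_mul_cos_eq_zero hb hcos hineq hθ hz⟩

end Summit.CriticalPhenomena.Ising3DConformalLimit.PerfectScreeningCoulombImpliesNontrivial
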